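import Mathlib
import Summits.QuantumFields.YangMills.Theses.SpecificationCompactness

/-!
# `Assembly` (route SpecificationCompactness, stmt-QuantumFields-28255) — PROVED (pure composition)

`PointwiseSpecificationLimit → UnitDensityUI → AveragedSpecificationLimit → GibbsLimitUniqueness → WeakLimitToLeaf → YM3TorusSU2` is
exactly the route's deciding theorem `SpecificationCompactness.closes` (planner ym-idea-5 g9, kernel-checked in the route file), read as an
implication.  Rung R3 RECORD line: nothing is proved about the cruxes themselves, the leaf `YM3TorusSU2`, or the YM mass gap.
-/

namespace Summit.QuantumFields.YangMills.Theorems.SpecificationCompactnessWeakLimit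

/-- **`Assembly` (stmt-QuantumFields-28255) HOLDS**: the five items of route SpecificationCompactness give the rung-R3 leaf `YM3TorusSU2`, by the
route's deciding theorem `closes`.  No summit statement is proved. [cite: JaffeWittenClay2006, §6.5 p.11] -/
theorem assembly_proof : Summit.QuantumFields.YangMills.Theses.SpecificationCompactness.Assembly :=
  fun h1 h2 h3 h4 h5 => Summit.QuantumFields.YangMills.Theses.SpecificationCompactness.closes h1 h2 h3 h4 h5

end Summit.QuantumFields.YangMills.Theorems.SpecificationCompactnessWeakLimit
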